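/-
Copyright (c) 2026. All rights reserved.
Released under Apache 2.0 license as described in the file LICENSE.
Authors: HodgeCM-Mathlib publication cell (pub/hodgecm-mathlib), floor-0 programme P4, seat F0P4-p06.
-/
import Literature.NumberTheory.GelbartRogawski1991.UnitaryDualPairThetaKernel
import Literature.NumberTheory.Weil1964.AdelicMetaplecticRationalLiftIsometric
import Literature.NumberTheory.Automorphic.UnitaryGroupOfFormAdelicTopology
import HarnessLib

/-!
# The Weil representation along a compatible pair splitting is `L²`-isometric (both quotients compact)

Topic `NumberTheory/GelbartRogawski1991`; namespace `Literature.NumberTheory.GelbartRogawski1991.UnitaryDualPair`.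
KERNEL ONLY: theorems, no definition, no named fact, nothing of [GelbartRogawski1991] / [Weil1964] / [Li1992] asserted.

Setting (`UnitaryDualPairSplittingDatum`, `UnitaryDualPairThetaKernel`): a quadratic extension `E/F` of number fields
with conjugation `c`, hermitian Gram data `J_V = T_V ⊗ 1 ∈ GL_N(E)`, `J_W = T_W ⊗ 1 ∈ GL_M(E)` (`T_V`, `T_W` rational
symmetric nonsingular), an enumeration `e : Fin N × Fin M ≃ Fin n`, the adelic Gram matrix `𝕋 = adelicGram F e T_V T_W`
of `𝕎 = Res_{E/F}(V ⊗ W)`, the group `Mp_ψ(𝕎_𝔸)ᶜᵒⁿᵗ = adelicMpCont F (Fin n) 𝕋` and a COMPATIBLE splitting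
`s : U(J_V ⊗ J_W)(𝔸_F) →* Mp_ψ(𝕎_𝔸)ᶜᵒⁿᵗ` ([GelbartRogawski1991, Prop. 3.1.1]: `π ∘ s = ι` and `s(G₁(F)) ⊆ i(Sp_F(𝕎))`,
`i = r_F` Weil's Θ-fixing section `ratThetaLiftCont`, `SplittingDatum.IsCompatible`) with continuous pair splitting
`s_pair : U(J_V)(𝔸_F) × U(J_W)(𝔸_F) →* Mp_ψ(𝕎_𝔸)ᶜᵒⁿᵗ` (`pairSplitting`).

Every operator `ω_ψ(p)`, `p ∈ Mp_ψ(𝕎_𝔸)ᶜᵒⁿᵗ`, is `L²(ν_X)`-isometric on `𝒮(𝔸_Fⁿ)` UP TO a positive constant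
`adelicMpCont.l2Scaling ν_X p` (`AdelicMetaplecticUnitaryLegContinuity` §2: multiplicative, continuous along
coefficient-continuous homomorphisms; the tree's `Mp_ψ(𝕎_𝔸)ᶜᵒⁿᵗ` has kernel `ℂˣ`, so the constant is a genuine
condition on the splitting).  This file proves:

* §1 (private) `monoidHom_apply_eq_one_of_compactSpace_quotient` — a continuous POSITIVE real character of a topological group
  that is trivial on a subgroup `Γ` with `G ⧸ Γ` compact is trivial (it descends to a bounded function on the compact
  quotient; `t > 1` would give unbounded powers); whence `adelicMpCont.l2Scaling_comp_hom_eq_one_of_compactSpace_quotient`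
  — the `L²` scaling along a coefficient-continuous homomorphism `t : G →* Mp_ψ(𝕎_𝔸)ᶜᵒⁿᵗ` that is `L²`-isometric on such a
  `Γ` is identically `1`;
* §2 **`l2Scaling_pairSplitting_eq_one`** — if the two automorphic quotients `U(J_V)(F)\U(J_V)(𝔸_F)`,
  `U(J_W)(F)\U(J_W)(𝔸_F)` are COMPACT (both spaces anisotropic — the standing hypotheses of the tree's Rallis inner
  product formula `Li1992.RallisInnerProductFormulaUnitaryDualPair`), then `l2Scaling ν_X (s_pair p) = 1` for every `p`,
  UNCONDITIONALLY: compatibility puts `s_pair(γ_U, γ)` in `r_F(Sp_{2n}(F))` for rational `γ_U`, `γ`, Weil's section `r_F` is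
  `L²(ν_X)`-isometric on `Sp_{2n}(F)` (`adelicMpCont.l2Scaling_ratThetaLiftCont` of `AdelicMetaplecticRationalLiftIsometric`:
  [Weil1964, Chap. I n° 13, Chap. III n° 40], rational Levi factors have `|det|_𝔸 = 1`, the unipotent and Weyl generators are
  isometries), so the scaling character is trivial on the rational points of each factor, and §1 applies factor by factor;
* **`lintegral_enorm_sq_pairRep_eq`** (`_of_continuous`) — the same in the exact shape of the `hiso` binder of
  `Li1992.RallisInnerProductFormulaUnitaryDualPair` («`ω = ω_ψ ∘ s_pair` is unitary for `L²(X(A), ν_X)` on `S(X(A))`»,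
  [Li1992, p. 178]): `∫⁻ ‖(ω_ψ ∘ s_pair)(p) Φ‖ₑ² dν_X = ∫⁻ ‖Φ‖ₑ² dν_X`.

NOT here: the isotropic case (non-compact quotient, where the scaling character of `U(J_V)(𝔸_F)` must first be factored
through `det`, `UnitaryGroupAdelicCharactersDet`, before the compact torus quotient `[U(1)]` kills it), any instantiation
at CM data (the consumer applies the theorem at its `splittingDatum`, e.g. with `hs := hsChiD …`, `hsc := hscChiD …`).

## References
* [GelbartRogawski1991] S. Gelbart, J. Rogawski, Invent. Math. 105 (1991) 445–472, §3.1 Prop. 3.1.1 p. 455, Remark p. 457.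
* [Weil1964] A. Weil, Acta Math. 111 (1964) 143–211, Chap. I n° 13 p. 160, Chap. III n° 40–41 pp. 190–193.
* [Li1992] J.-S. Li, J. reine angew. Math. 428 (1992) 177–217, p. 178, Thm. 2.1 p. 184.
* [Godement1964] R. Godement, Sém. Bourbaki 257 (1962/63), §5 Thm. 4 (compactness of the anisotropic quotient).
-/

set_option autoImplicit false

noncomputable section

open scoped Matrix ENNReal
open NumberField MeasureTheory MeasureTheory.Measure

namespace Literature.NumberTheory.Weil1964

/-! ## §1 Positive real characters trivial on a co-compact subgroup -/

/-- **A continuous positive real character of a topological group, trivial on a subgroup with compact quotient, is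
trivial.**  `f : G →* (ℝ, ·)` continuous with `0 < f`, `f = 1` on `Γ`, `G ⧸ Γ` compact ⇒ `f = 1`: `f` is constant on
the cosets `g Γ`, so it descends to a continuous — hence bounded — function on `G ⧸ Γ`; if `f g > 1` then
`f (g ^ m) = (f g) ^ m` is unbounded, so `f ≤ 1`, and `f g⁻¹ ≤ 1` gives `f g ≥ 1`.  (Private plumbing: the same argument as
the tree's `UnitaryGroupAdelicOneTorusDictionary.norm_apply_eq_one_of_compactSpace_aux`, for a non-normal co-compact subgroup.)
[folklore] -/
private theorem monoidHom_apply_eq_one_of_compactSpace_quotient {G : Type*} [Group G] [TopologicalSpace G]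
    (Γ : Subgroup G) [CompactSpace (G ⧸ Γ)] (f : G →* ℝ) (hf : Continuous f) (hpos : ∀ g, 0 < f g)
    (hΓ : ∀ γ ∈ Γ, f γ = 1) (g : G) : f g = 1 := by
  -- `f` descends to the quotient
  let fbar : G ⧸ Γ → ℝ := fun q => f q.out
  have hfbar : ∀ x : G, fbar (x : G ⧸ Γ) = f x := by
    intro x
    obtain ⟨h, hh⟩ := QuotientGroup.mk_out_eq_mul Γ x
    show f (Quotient.out (x : G ⧸ Γ)) = f x
    rw [hh, map_mul, hΓ _ h.2, mul_one]
  have hcont : Continuous fbar := by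
    rw [(QuotientGroup.isQuotientMap_mk Γ).continuous_iff]
    have hcomp : fbar ∘ QuotientGroup.mk = f := funext hfbar
    rw [hcomp]
    exact hf
  obtain ⟨C, hC⟩ := (isCompact_range hcont).isBounded.bddAbove
  have hbd : ∀ x : G, f x ≤ C := fun x => by
    rw [← hfbar x]
    exact hC (Set.mem_range_self _)
  have hle : ∀ x : G, f x ≤ 1 := fun x => not_lt.mp fun hlt => by
    obtain ⟨m, hm⟩ := pow_unbounded_of_one_lt C hlt
    have h := hbd (x ^ m)
    rw [map_pow] at h
    exact absurd h (not_le.mpr hm)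
  refine le_antisymm (hle g) (not_lt.mp fun hlt => ?_)
  have hmul : f g * f g⁻¹ = 1 := by rw [← map_mul, mul_inv_cancel, map_one]
  exact (mul_lt_one_of_nonneg_of_lt_one_left (hpos g).le hlt (hle g⁻¹)).ne hmul

open Literature.NumberTheory.Automorphic Literature.RepresentationTheory.HeisenbergGroup

variable (F : Type) [Field F] [NumberField F] {n : ℕ}
  (T : Matrix (Fin n) (Fin n) (AdeleRing (𝓞 F) F)) (hT : IsUnit T.det)
  [MeasurableSpace (AdeleRing (𝓞 F) F)] [BorelSpace (AdeleRing (𝓞 F) F)]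
  (ν : Measure (Fin n → AdeleRing (𝓞 F) F)) [ν.IsAddHaarMeasure]

section Hom

variable {G : Type*} [Group G] [TopologicalSpace G] [IsTopologicalGroup G] [LocallyCompactSpace G]
  [SecondCountableTopology G] [TopologicalSpace.MetrizableSpace G] [MeasurableSpace G] [BorelSpace G]
  (t : G →* adelicMpCont F (Fin n) T) (ht : Continuous fun g => (t g : adelicMp F (Fin n) T))

include ht in
/-- **the `L²` scaling along a coefficient-continuous homomorphism `t : G →* Mp_ψ(𝕎_𝔸)ᶜᵒⁿᵗ` that is trivial on a
subgroup `Γ` with `G ⧸ Γ` compact is trivial**: `g ↦ l2Scaling ν (t g)` is a continuous (Steinhaus–Weil,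
`adelicMpCont.continuous_l2Scaling_comp_hom`) positive real character of `G`, so §1 applies.
[cite: Weil1964, Chap. I n° 13 p. 160] -/
theorem adelicMpCont.l2Scaling_comp_hom_eq_one_of_compactSpace_quotient (Γ : Subgroup G) [CompactSpace (G ⧸ Γ)]
    (hΓ : ∀ γ ∈ Γ, adelicMpCont.l2Scaling F T hT ν (t γ) = 1) (g : G) :
    adelicMpCont.l2Scaling F T hT ν (t g) = 1 := by
  -- the scaling character, bundled as a hom into `(ℝ, ·)`
  let f : G →* ℝ :=
    { toFun := fun g => (adelicMpCont.l2Scaling F T hT ν (t g)).toReal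
      map_one' := by
        simp only [map_one, adelicMpCont.l2Scaling_one, ENNReal.toReal_one]
      map_mul' := fun a b => by
        simp only [map_mul, adelicMpCont.l2Scaling_mul, ENNReal.toReal_mul] }
  have hf : Continuous f := adelicMpCont.continuous_l2Scaling_comp_hom F T hT ν t ht
  have hpos : ∀ g, 0 < f g := fun g =>
    ENNReal.toReal_pos (adelicMpCont.l2Scaling_ne_zero F T hT ν (t g)) (adelicMpCont.l2Scaling_ne_top F T hT ν (t g))
  have hΓ' : ∀ γ ∈ Γ, f γ = 1 := fun γ hγ => by
    show (adelicMpCont.l2Scaling F T hT ν (t γ)).toReal = 1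
    rw [hΓ γ hγ, ENNReal.toReal_one]
  have h := monoidHom_apply_eq_one_of_compactSpace_quotient Γ f hf hpos hΓ' g
  exact (ENNReal.toReal_eq_one_iff _).1 h

end Hom

end Literature.NumberTheory.Weil1964

namespace Literature.NumberTheory.GelbartRogawski1991

namespace UnitaryDualPair

open Literature.NumberTheory.Automorphic Literature.NumberTheory.Weil1964
  Literature.RepresentationTheory.HeisenbergGroup

/-! ## §2 The scaling character of a compatible pair splitting is trivial -/

variable (F E : Type) [Field F] [NumberField F] [Field E] [NumberField E] [Algebra F E]
variable (c : E ≃ₐ[F] E) (N M : ℕ) {n : ℕ} (e : Fin N × Fin M ≃ Fin n)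
variable (JV : Matrix (Fin N) (Fin N) E) (JW : Matrix (Fin M) (Fin M) E)
variable {TV : Matrix (Fin N) (Fin N) F} {TW : Matrix (Fin M) (Fin M) F}
variable [Algebra.IsQuadraticExtension F E] {δ : E} (hcδ : c δ = -δ) (hδ : δ ≠ 0) {d : F}
  (hd : δ * δ = algebraMap F E d) (hV : TV.IsSymm) (hW : TW.IsSymm) (hVd : IsUnit TV.det) (hWd : IsUnit TW.det)
  (hJV : JV = TV.map (algebraMap F E)) (hJW : JW = TW.map (algebraMap F E))
variable [MeasurableSpace (AdeleRing (𝓞 F) F)] [BorelSpace (AdeleRing (𝓞 F) F)]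
  (νX : Measure (Fin n → AdeleRing (𝓞 F) F)) [νX.IsAddHaarMeasure]

/-- **Compatibility ⇒ the scaling character is trivial on rational points.**  For a compatible splitting `s`
(`π ∘ s = ι`, `s(G₁(F)) ⊆ r_F(Sp_{2n}(F))`) and rational `γ_U ∈ U(J_V)(F)`, `γ ∈ U(J_W)(F)`:
`s_pair(γ_U, γ) = r_F(A)` for some `A ∈ Sp_{2n}(F)` (`SplittingDatum.IsCompatible.pair`, `ratSection`), so
`l2Scaling ν_X (s_pair(γ_U, γ)) = 1` because `r_F` is `L²(ν_X)`-isometric (`adelicMpCont.l2Scaling_ratThetaLiftCont`).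
[cite: GelbartRogawski1991, §3.1 Prop. 3.1.1 p. 455 L1–3] -/
theorem l2Scaling_pairSplitting_eq_one_of_mem_range
    (s : UnitaryGroup.adelicPair F E c N M JV JW →* adelicMpCont F (Fin n) (adelicGram F e TV TW))
    (hs : (splittingDatum F E c N M e JV JW hcδ hδ hd hV hW hVd hWd hJV hJW).IsCompatible s)
    {γU : UnitaryGroup.adelic F E c N JV} (hγU : γU ∈ (UnitaryGroup.toAdelic F E c N JV).range)
    {γ : UnitaryGroup.adelic F E c M JW} (hγ : γ ∈ (UnitaryGroup.toAdelic F E c M JW).range) :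
    adelicMpCont.l2Scaling F (adelicGram F e TV TW) (isUnit_det_adelicGram F e hVd hWd) νX
      (pairSplitting F E c N M e JV JW s (γU, γ)) = 1 := by
  have ha : ∀ γ ∈ (UnitaryGroup.toAdelic F E c N JV).range, UnitaryGroup.adelicInl F E c N M JV JW γ ∈
      (splittingDatum F E c N M e JV JW hcδ hδ hd hV hW hVd hWd hJV hJW).ratPts := by
    rintro _ ⟨γ, rfl⟩
    exact UnitaryGroup.adelicInl_toAdelic_mem_range F E c N M JV JW γ
  have hb : ∀ γ ∈ (UnitaryGroup.toAdelic F E c M JW).range, UnitaryGroup.adelicInr F E c N M JV JW γ ∈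
      (splittingDatum F E c N M e JV JW hcδ hδ hd hV hW hVd hWd hJV hJW).ratPts := by
    rintro _ ⟨γ, rfl⟩
    exact UnitaryGroup.adelicInr_toAdelic_mem_range F E c N M JV JW γ
  obtain ⟨x, hx⟩ := (hs.pair _ _ (UnitaryGroup.commute_adelicInl_adelicInr F E c N M JV JW) ha hb).2 γU hγU γ hγ
  -- `pairSplitting s = s ∘ (inl · inr)` and `D.ratSplit = ratSection = r_F ∘ (ratSp-range ≃ Sp_{2n}(F))`, by definition
  change ratThetaLiftCont F (adelicGram F e TV TW) (isUnit_det_adelicGram F e hVd hWd)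
      ((MonoidHom.ofInjective (ratSp_injective F (adelicGram F e TV TW) (isUnit_det_adelicGram F e hVd hWd))).symm x) =
    pairSplitting F E c N M e JV JW s (γU, γ) at hx
  rw [← hx]
  exact adelicMpCont.l2Scaling_ratThetaLiftCont F (adelicGram F e TV TW) (isUnit_det_adelicGram F e hVd hWd) νX _

/-- **[GelbartRogawski1991, Prop. 3.1.1] compatible splitting ⇒ `ω_ψ ∘ s_pair` is `L²(ν_X)`-isometric, when both
quotients `U(J_V)(F)\U(J_V)(𝔸_F)`, `U(J_W)(F)\U(J_W)(𝔸_F)` are compact.**  `l2Scaling ν_X (s_pair p) = 1` for every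
`p ∈ U(J_V)(𝔸_F) × U(J_W)(𝔸_F)`: by `s_pair(g, h) = s_pair(g, 1) s_pair(1, h)` and multiplicativity it suffices to treat
the two factors; on each, `g ↦ l2Scaling ν_X (s_pair(g, 1))` is a continuous positive character of the second-countable
locally compact group `U(J)(𝔸_F)` (`UnitaryGroupOfFormAdelicTopology`, Steinhaus–Weil), trivial on `U(J)(F)` by
compatibility and the `L²`-isometry of `r_F` (`l2Scaling_pairSplitting_eq_one_of_mem_range`), hence trivial (§1, compact
quotient).  No hypothesis beyond the data: the isometry of Weil's section is `adelicMpCont.l2Scaling_ratThetaLiftCont`.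
[cite: GelbartRogawski1991, §3.1 Prop. 3.1.1 p. 455 L1–3, Remark p. 457] -/
theorem l2Scaling_pairSplitting_eq_one
    (s : UnitaryGroup.adelicPair F E c N M JV JW →* adelicMpCont F (Fin n) (adelicGram F e TV TW))
    (hs : (splittingDatum F E c N M e JV JW hcδ hδ hd hV hW hVd hWd hJV hJW).IsCompatible s)
    (hsc : Continuous (pairSplitting F E c N M e JV JW s))
    [CompactSpace (UnitaryGroup.adelic F E c N JV ⧸ (UnitaryGroup.toAdelic F E c N JV).range)]
    [CompactSpace (UnitaryGroup.adelic F E c M JW ⧸ (UnitaryGroup.toAdelic F E c M JW).range)]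
    (p : UnitaryGroup.adelic F E c N JV × UnitaryGroup.adelic F E c M JW) :
    adelicMpCont.l2Scaling F (adelicGram F e TV TW) (isUnit_det_adelicGram F e hVd hWd) νX
      (pairSplitting F E c N M e JV JW s p) = 1 := by
  borelize ↥(UnitaryGroup.adelic F E c N JV) ↥(UnitaryGroup.adelic F E c M JW)
  -- the first factor `g ↦ s_pair (g, 1)`
  have h1 : adelicMpCont.l2Scaling F (adelicGram F e TV TW) (isUnit_det_adelicGram F e hVd hWd) νX
      (pairSplitting F E c N M e JV JW s (p.1, 1)) = 1 := by
    have ht : Continuous fun g : UnitaryGroup.adelic F E c N JV =>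
        (((pairSplitting F E c N M e JV JW s).comp (MonoidHom.inl _ _) g :
          adelicMpCont F (Fin n) (adelicGram F e TV TW)) : adelicMp F (Fin n) (adelicGram F e TV TW)) :=
      continuous_subtype_val.comp (hsc.comp (continuous_id.prodMk continuous_const))
    exact adelicMpCont.l2Scaling_comp_hom_eq_one_of_compactSpace_quotient F (adelicGram F e TV TW)
      (isUnit_det_adelicGram F e hVd hWd) νX ((pairSplitting F E c N M e JV JW s).comp (MonoidHom.inl _ _)) ht
      (UnitaryGroup.toAdelic F E c N JV).range
      (fun γ hγ => l2Scaling_pairSplitting_eq_one_of_mem_range F E c N M e JV JW hcδ hδ hd hV hW hVd hWd hJV hJW νX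
        s hs hγ (one_mem _)) p.1
  -- the second factor `h ↦ s_pair (1, h)`
  have h2 : adelicMpCont.l2Scaling F (adelicGram F e TV TW) (isUnit_det_adelicGram F e hVd hWd) νX
      (pairSplitting F E c N M e JV JW s (1, p.2)) = 1 := by
    have ht : Continuous fun g : UnitaryGroup.adelic F E c M JW =>
        (((pairSplitting F E c N M e JV JW s).comp (MonoidHom.inr _ _) g :
          adelicMpCont F (Fin n) (adelicGram F e TV TW)) : adelicMp F (Fin n) (adelicGram F e TV TW)) :=
      continuous_subtype_val.comp (hsc.comp (continuous_const.prodMk continuous_id))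
    exact adelicMpCont.l2Scaling_comp_hom_eq_one_of_compactSpace_quotient F (adelicGram F e TV TW)
      (isUnit_det_adelicGram F e hVd hWd) νX ((pairSplitting F E c N M e JV JW s).comp (MonoidHom.inr _ _)) ht
      (UnitaryGroup.toAdelic F E c M JW).range
      (fun γ hγ => l2Scaling_pairSplitting_eq_one_of_mem_range F E c N M e JV JW hcδ hδ hd hV hW hVd hWd hJV hJW νX
        s hs (one_mem _) hγ) p.2
  rw [← Prod.fst_mul_snd p, map_mul, adelicMpCont.l2Scaling_mul, h1, h2, mul_one]

/-- **The `hiso` binder of `Li1992.RallisInnerProductFormulaUnitaryDualPair`, discharged for every compatible splitting with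
continuous pair splitting when both quotients are compact**: `∫⁻ ‖(ω_ψ ∘ s_pair)(p) Φ‖ₑ² dν_X = ∫⁻ ‖Φ‖ₑ² dν_X` for all
`p` and all `Φ ∈ 𝒮(𝔸_Fⁿ)` — «`ω` extends to a unitary representation on `L²(X(A))`», print's standing assumption.
[cite: Li1992, p. 178] [cite: GelbartRogawski1991, §3.1 Prop. 3.1.1 p. 455 L1–3] -/
theorem lintegral_enorm_sq_pairRep_eq
    (s : UnitaryGroup.adelicPair F E c N M JV JW →* adelicMpCont F (Fin n) (adelicGram F e TV TW))
    (hs : (splittingDatum F E c N M e JV JW hcδ hδ hd hV hW hVd hWd hJV hJW).IsCompatible s)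
    (hsc : Continuous (pairSplitting F E c N M e JV JW s))
    [CompactSpace (UnitaryGroup.adelic F E c N JV ⧸ (UnitaryGroup.toAdelic F E c N JV).range)]
    [CompactSpace (UnitaryGroup.adelic F E c M JW ⧸ (UnitaryGroup.toAdelic F E c M JW).range)]
    (p : UnitaryGroup.adelic F E c N JV × UnitaryGroup.adelic F E c M JW) (Φ : piSchwartzBruhat F (Fin n)) :
    ∫⁻ x, ‖(pairRep F E c N M e JV JW s p Φ : (Fin n → AdeleRing (𝓞 F) F) → ℂ) x‖ₑ ^ 2 ∂νX =
      ∫⁻ x, ‖(Φ : (Fin n → AdeleRing (𝓞 F) F) → ℂ) x‖ₑ ^ 2 ∂νX := by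
  rw [pairRep_apply, adelicMpCont.lintegral_enorm_sq_omega F (adelicGram F e TV TW) (isUnit_det_adelicGram F e hVd hWd) νX,
    l2Scaling_pairSplitting_eq_one F E c N M e JV JW hcδ hδ hd hV hW hVd hWd hJV hJW νX s hs hsc p, one_mul]

/-- the same with the continuity hypothesis on `s` itself (`continuous_pairSplitting`) and in the `∀ p Φ` shape of the
`hiso` binder of `Li1992.RallisInnerProductFormulaUnitaryDualPair`, ready to be passed as that argument.
[cite: Li1992, p. 178] [cite: GelbartRogawski1991, §3.1 Prop. 3.1.1 p. 455 L1–3] -/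
theorem lintegral_enorm_sq_pairRep_eq_of_continuous
    (s : UnitaryGroup.adelicPair F E c N M JV JW →* adelicMpCont F (Fin n) (adelicGram F e TV TW))
    (hs : (splittingDatum F E c N M e JV JW hcδ hδ hd hV hW hVd hWd hJV hJW).IsCompatible s) (hsc : Continuous s)
    [CompactSpace (UnitaryGroup.adelic F E c N JV ⧸ (UnitaryGroup.toAdelic F E c N JV).range)]
    [CompactSpace (UnitaryGroup.adelic F E c M JW ⧸ (UnitaryGroup.toAdelic F E c M JW).range)] :
    ∀ (p : UnitaryGroup.adelic F E c N JV × UnitaryGroup.adelic F E c M JW) (Φ : piSchwartzBruhat F (Fin n)),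
      ∫⁻ x, ‖(pairRep F E c N M e JV JW s p Φ : (Fin n → AdeleRing (𝓞 F) F) → ℂ) x‖ₑ ^ 2 ∂νX =
        ∫⁻ x, ‖(Φ : (Fin n → AdeleRing (𝓞 F) F) → ℂ) x‖ₑ ^ 2 ∂νX :=
  fun p Φ => lintegral_enorm_sq_pairRep_eq F E c N M e JV JW hcδ hδ hd hV hW hVd hWd hJV hJW νX s hs
    (continuous_pairSplitting F E c N M e JV JW hsc) p Φ

end UnitaryDualPair

end Literature.NumberTheory.GelbartRogawski1991

end
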